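import Literature.NumberTheory.Automorphic.IdeleUnitBoxSplitting
import Literature.NumberTheory.Automorphic.AdelicSecondCountable
import HarnessLib

/-!
# Exhaustion of the ideles by the boxes `B(Sᶜ)` and the relative shell decomposition
# `B((S ∪ T)ᶜ) = ⨆_{m ∈ ℤ^T} ϖ^m B(Sᶜ)` (Tate (1967), §4.3: integration over the `S`-ideles)

Topic `NumberTheory/Automorphic`; namespace `Literature.NumberTheory.Automorphic`. Theorems only (no
definition, no named fact, no instance). `B(G) = ideleUnitBox G` (`IdeleUnitBoxShells`) is the set of ideles
that are local units at every finite place of `G`; `B(Sᶜ)` for a finite `S` is the group `𝕀_{K,S}` of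
`S`-ideles (times `K_∞ˣ`). This file supplies the two pieces of plumbing through which an integral over
ALL of `𝕀_K` of an Eulerian integrand is computed from its integrals over the boxes — the passage
"`Ψ(s, φ) = ∏_v Ψ(s, W_v)`" of Jacquet–Langlands (1970), p. 171 (proof of (11.1.2)) and Cogdell (2004), §2.3:

* `ideleUnitBox_anti`, `monotone_ideleUnitBox_compl`, `exists_mem_ideleUnitBox_compl`, `iUnion_ideleUnitBox_compl` — the boxes `B(Sᶜ)` increase with `S` and
  EXHAUST `𝕀_K` (an idele is a unit at almost every place);
* `tendsto_setIntegral_ideleUnitBox_compl` — hence `∫_{B(Sᶜ)} f dν → ∫_{𝕀_K} f dν` along the finite sets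
  `S ↑` for `f` integrable (`tendsto_setIntegral_of_monotone`; the finite places are countable), and
  `lintegral_eq_iSup_setLIntegral_ideleUnitBox_compl` — `∫⁻ h dν = ⨆_S ∫⁻_{B(Sᶜ)} h dν` for `h ≥ 0`, whence
  `integrable_of_setLIntegral_ideleUnitBox_compl_le` — a uniform bound for `∫⁻_{B(Sᶜ)} ‖f‖ dν` gives
  integrability on `𝕀_K` (absolute convergence of the unfolded integral from its Euler factorisation);
* `ideleUnitBox_compl_union_eq_iUnion`, `pairwise_disjoint_shellIdele_smul_ideleUnitBox_compl` — **the
  relative shell decomposition**: for finite `S`, `T` with `T ∩ S = ∅` and uniformizers `ϖ_v`,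

    `B((S ∪ T)ᶜ) = ⨆_{m ∈ ℤ^T} ϖ^m · B(Sᶜ)`,   `ϖ^m = ∏_{v ∈ T} ι_v(ϖ_v^{m_v})` (`shellIdele`),

  a disjoint union (the case `S = ∅` is `ideleUnitBox_compl_eq_iUnion` of `IdeleUnitBoxShells`);
* `setLIntegral_ideleUnitBox_compl_union_eq_tsum`, `hasSum_setIntegral_ideleUnitBox_compl_union`,
  `integrableOn_shell_of_integrableOn_ideleUnitBox_compl_union` — hence, for a left-invariant `ν`,

    `∫_{B((S ∪ T)ᶜ)} f dν = Σ_{m ∈ ℤ^T} ∫_{B(Sᶜ)} f(ϖ^m b) dν(b)`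

  for `f ≥ 0` (in `[0, ∞]`) and for `f` integrable on `B((S ∪ T)ᶜ)` (Bochner, as a `HasSum`), the shells
  `b ↦ f(ϖ^m b)` of an integrable `f` being integrable on `B(Sᶜ)`.

## References

* J. Tate, *Fourier analysis in number fields and Hecke's zeta-functions*, in Cassels–Fröhlich (1967),
  Ch. XV §4.3 [CasselsFrohlichANT1967].
* H. Jacquet, R. P. Langlands, *Automorphic Forms on GL(2)*, LNM 114 (1970), §11, p. 171 [JacquetLanglands1970].
* J. W. Cogdell, *Lectures on L-functions, converse theorems, and functoriality for GL_n* (2004), §2.3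
  [CogdellAnalyticTheory2004].
-/

noncomputable section

open MeasureTheory Measure NumberField IsDedekindDomain Set Filter WithZero Topology
open Literature.NumberTheory.GaloisRepresentations (ideleGroup unitIdeles localUnits)
open scoped ENNReal NNReal Pointwise Classical

namespace Literature.NumberTheory.Automorphic

variable {K : Type} [Field K] [NumberField K]

/-! ### 1. The boxes `B(Sᶜ)` exhaust `𝕀_K` -/

section Boxes

/-- `B(·)` is antitone: more unit conditions, smaller box. [folklore] -/
theorem ideleUnitBox_anti {G G' : Set (HeightOneSpectrum (𝓞 K))} (h : G ⊆ G') :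
    ideleUnitBox (K := K) G' ⊆ ideleUnitBox G := fun _ hy w hw => hy w (h hw)

/-- The boxes `B(Sᶜ)` increase with the finite set `S`. [folklore] -/
theorem monotone_ideleUnitBox_compl :
    Monotone fun S : Finset (HeightOneSpectrum (𝓞 K)) => ideleUnitBox (K := K) {w | w ∉ S} :=
  fun _ _ hSS' => ideleUnitBox_anti fun _ hw hwS => hw (hSS' hwS)

/-- **An idele is a local unit at almost every place**: the set of finite places `w` with `|a_w|_w ≠ 1` is
finite (the finite part of `a` and of `a⁻¹` are integral at almost every place; a private copy of
`finite_setOf_valued_snd_ne_one` of `MultipliableLGL2`, to keep the imports of this file light). [folklore] -/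
private theorem finite_setOf_valued_snd_ne_one' (a : ideleGroup K) :
    {w : HeightOneSpectrum (𝓞 K) | Valued.v (((a : ideleGroup K) : AdeleRing (𝓞 K) K).2 w) ≠ 1}.Finite := by
  have h1 : ∀ᶠ w : HeightOneSpectrum (𝓞 K) in cofinite,
      ((a : ideleGroup K) : AdeleRing (𝓞 K) K).2 w ∈ w.adicCompletionIntegers K :=
    (((a : ideleGroup K) : AdeleRing (𝓞 K) K).2).2
  have h2 : ∀ᶠ w : HeightOneSpectrum (𝓞 K) in cofinite,
      (((a⁻¹ : ideleGroup K)) : AdeleRing (𝓞 K) K).2 w ∈ w.adicCompletionIntegers K :=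
    ((((a⁻¹ : ideleGroup K)) : AdeleRing (𝓞 K) K).2).2
  refine ((h1.and h2).mono fun w hw => ?_)
  rw [HeightOneSpectrum.mem_adicCompletionIntegers, HeightOneSpectrum.mem_adicCompletionIntegers] at hw
  have hmul : ((a : ideleGroup K) : AdeleRing (𝓞 K) K).2 w * (((a⁻¹ : ideleGroup K)) : AdeleRing (𝓞 K) K).2 w = 1 := by
    rw [← GaloisRepresentations.ideleGroup_val_snd_mul, mul_inv_cancel]
    rfl
  have hv := congrArg Valued.v hmul
  rw [map_mul, map_one] at hv
  exact eq_one_of_le_one_of_mul_eq_one hw.1 hw.2 hv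

/-- Every idele lies in some box `B(Sᶜ)`. [folklore] -/
theorem exists_mem_ideleUnitBox_compl (a : ideleGroup K) :
    ∃ S : Finset (HeightOneSpectrum (𝓞 K)), a ∈ ideleUnitBox (K := K) {w | w ∉ S} := by
  refine ⟨(finite_setOf_valued_snd_ne_one' a).toFinset, fun w hw => ?_⟩
  by_contra h
  exact hw ((finite_setOf_valued_snd_ne_one' a).mem_toFinset.2 h)

/-- **The boxes `B(Sᶜ)` exhaust `𝕀_K`.** [cite: CasselsFrohlichANT1967, Ch. XV §4.3] -/
theorem iUnion_ideleUnitBox_compl :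
    (⋃ S : Finset (HeightOneSpectrum (𝓞 K)), ideleUnitBox (K := K) {w | w ∉ S}) = Set.univ :=
  Set.eq_univ_of_forall fun a => Set.mem_iUnion.2 (exists_mem_ideleUnitBox_compl a)

end Boxes

/-! ### 2. The relative shell decomposition `B((S ∪ T)ᶜ) = ⨆_m ϖ^m B(Sᶜ)` -/

section RelativeShells

variable (ϖ : ∀ v : HeightOneSpectrum (𝓞 K), (v.adicCompletion K)ˣ)

/-- Uniformizer powers: `|ϖ^k| = e^{-k}`. [folklore] -/
private theorem valued_zpow_uniformizer'' {v : HeightOneSpectrum (𝓞 K)} {π : (v.adicCompletion K)ˣ}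
    (hπ : Valued.v (π : v.adicCompletion K) = exp (-1 : ℤ)) (k : ℤ) :
    Valued.v (((π ^ k : (v.adicCompletion K)ˣ) : v.adicCompletion K)) = exp (-k) := by
  rw [Units.val_zpow_eq_zpow_val, map_zpow₀, hπ, ← WithZero.exp_zsmul, smul_eq_mul, mul_neg, mul_one]

/-- The valuation of the `v`-component of `ϖ^m b`, `v ∈ T`, when `b` is a unit at `v`. [folklore] -/
theorem valued_shellIdele_mul_snd_of_valued_eq_one
    (hϖ : ∀ v, Valued.v ((ϖ v : (v.adicCompletion K)ˣ) : v.adicCompletion K) = exp (-1 : ℤ))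
    {T : Finset (HeightOneSpectrum (𝓞 K))} (m : ↥T → ℤ) {b : ideleGroup K} (v : ↥T)
    (hb : Valued.v (((b : ideleGroup K) : AdeleRing (𝓞 K) K).2 v.1) = 1) :
    Valued.v ((((shellIdele ϖ T m * b : ideleGroup K)) : AdeleRing (𝓞 K) K).2 v.1) = exp (-m v) := by
  rw [GaloisRepresentations.ideleGroup_val_snd_mul, map_mul, shellIdele_snd_of_mem, valued_zpow_uniformizer'' (hϖ v.1),
    hb, mul_one]

/-- `ϖ^m b ∈ B((S ∪ T)ᶜ)` for `b ∈ B(Sᶜ)`. [folklore] -/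
theorem shellIdele_mul_mem_ideleUnitBox_compl_union {S T : Finset (HeightOneSpectrum (𝓞 K))} (m : ↥T → ℤ)
    {b : ideleGroup K} (hb : b ∈ ideleUnitBox (K := K) {w | w ∉ S}) :
    shellIdele ϖ T m * b ∈ ideleUnitBox (K := K) {w | w ∉ S ∪ T} := by
  intro w hw
  have hwS : w ∉ S := fun h => hw (Finset.mem_union_left T h)
  have hwT : w ∉ T := fun h => hw (Finset.mem_union_right S h)
  rw [GaloisRepresentations.ideleGroup_val_snd_mul, map_mul, shellIdele_snd_of_not_mem ϖ m hwT, map_one, one_mul]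
  exact hb w hwS

/-- **The relative shell decomposition** `B((S ∪ T)ᶜ) = ⋃_{m ∈ ℤ^T} ϖ^m B(Sᶜ)` (as a union no disjointness
hypothesis is needed; the union is disjoint when `T ∩ S = ∅`): an idele
that is a unit off `S ∪ T` is `ϖ^m b` with `m_v = -ord_v`, `v ∈ T`, and `b` a unit off `S`.
[cite: CasselsFrohlichANT1967, Ch. XV §4.3] -/
theorem ideleUnitBox_compl_union_eq_iUnion
    (hϖ : ∀ v, Valued.v ((ϖ v : (v.adicCompletion K)ˣ) : v.adicCompletion K) = exp (-1 : ℤ))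
    (S T : Finset (HeightOneSpectrum (𝓞 K))) :
    ideleUnitBox (K := K) {w | w ∉ S ∪ T} =
      ⋃ m : ↥T → ℤ, shellIdele ϖ T m • ideleUnitBox (K := K) {w | w ∉ S} := by
  ext y
  simp only [Set.mem_iUnion]
  constructor
  · intro hy
    -- the valuations at `T`
    have hex : ∀ v : ↥T, ∃ k : ℤ, Valued.v (((y : ideleGroup K) : AdeleRing (𝓞 K) K).2 v.1) = exp (-k) := by
      intro v
      have hne : Valued.v (((y : ideleGroup K) : AdeleRing (𝓞 K) K).2 v.1) ≠ 0 := by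
        intro h0
        have hmul : ((y : ideleGroup K) : AdeleRing (𝓞 K) K).2 v.1 * (((y⁻¹ : ideleGroup K)) : AdeleRing (𝓞 K) K).2 v.1 = 1 := by
          rw [← GaloisRepresentations.ideleGroup_val_snd_mul, mul_inv_cancel]; rfl
        have := congrArg Valued.v hmul
        rw [map_mul, h0, zero_mul, map_one] at this
        exact zero_ne_one this
      refine ⟨-Multiplicative.toAdd (unzero hne), ?_⟩
      rw [neg_neg]
      exact (coe_unzero hne).symm
    choose k hk using hex
    refine ⟨k, Set.mem_smul_set_iff_inv_smul_mem.2 ?_⟩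
    show (shellIdele ϖ T k)⁻¹ * y ∈ ideleUnitBox (K := K) {w | w ∉ S}
    intro w hwS
    rw [GaloisRepresentations.ideleGroup_val_snd_mul, GaloisRepresentations.ideleGroup_val_inv_snd, map_mul, map_inv₀]
    by_cases hw : w ∈ T
    · rw [shellIdele_snd_of_mem ϖ k ⟨w, hw⟩, valued_zpow_uniformizer'' (hϖ w), hk ⟨w, hw⟩, ← exp_neg, ← exp_add,
        neg_add_cancel, exp_zero]
    · rw [shellIdele_snd_of_not_mem ϖ k hw, map_one, inv_one, one_mul]
      exact hy w (by
        intro h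
        rcases Finset.mem_union.1 h with h | h
        · exact hwS h
        · exact hw h)
  · rintro ⟨m, hm⟩
    obtain ⟨b, hb, rfl⟩ := Set.mem_smul_set.1 hm
    exact shellIdele_mul_mem_ideleUnitBox_compl_union ϖ m hb

/-- The relative shells are pairwise disjoint (`T ∩ S = ∅`: the valuations at `T` of `ϖ^m b`, `b ∈ B(Sᶜ)`,
are `exp(-m_v)`). [folklore] -/
theorem pairwise_disjoint_shellIdele_smul_ideleUnitBox_compl
    (hϖ : ∀ v, Valued.v ((ϖ v : (v.adicCompletion K)ˣ) : v.adicCompletion K) = exp (-1 : ℤ))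
    {S T : Finset (HeightOneSpectrum (𝓞 K))} (hTS : ∀ v ∈ T, v ∉ S) :
    Pairwise (Function.onFun Disjoint fun m : ↥T → ℤ =>
      shellIdele ϖ T m • ideleUnitBox (K := K) {w | w ∉ S}) := by
  intro m m' hne
  refine Set.disjoint_left.2 fun y hy hy' => hne ?_
  obtain ⟨b, hb, rfl⟩ := Set.mem_smul_set.1 hy
  obtain ⟨b', hb', heq⟩ := Set.mem_smul_set.1 hy'
  funext v
  have h1 := valued_shellIdele_mul_snd_of_valued_eq_one ϖ hϖ m v (hb v.1 (hTS v.1 v.2))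
  have h2 := valued_shellIdele_mul_snd_of_valued_eq_one ϖ hϖ m' v (hb' v.1 (hTS v.1 v.2))
  have heq' : shellIdele ϖ T m' * b' = shellIdele ϖ T m * b := heq
  rw [heq', h1] at h2
  have := exp_injective h2
  omega

variable [MeasurableSpace (ideleGroup K)] [BorelSpace (ideleGroup K)]

/-- The relative shells are measurable. [folklore] -/
theorem measurableSet_shellIdele_smul_ideleUnitBox_compl
    (hϖ : ∀ v, Valued.v ((ϖ v : (v.adicCompletion K)ˣ) : v.adicCompletion K) = exp (-1 : ℤ))
    (S T : Finset (HeightOneSpectrum (𝓞 K))) (m : ↥T → ℤ) :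
    MeasurableSet (shellIdele ϖ T m • ideleUnitBox (K := K) {w | w ∉ S}) := by
  haveI : SecondCountableTopology (ideleGroup K) := secondCountableTopology_ideleGroup K
  haveI : MeasurableMul (ideleGroup K) := ContinuousMul.measurableMul
  exact (measurableSet_ideleUnitBox_compl ϖ hϖ S).const_smul _

variable (ν : Measure (ideleGroup K)) [ν.IsMulLeftInvariant]

/-- **`∫⁻_{B((S ∪ T)ᶜ)} h dν = Σ_{m ∈ ℤ^T} ∫⁻_{B(Sᶜ)} h(ϖ^m b) dν(b)`** for every `h ≥ 0` and every
left-invariant `ν` (`T ∩ S = ∅`). [cite: CasselsFrohlichANT1967, Ch. XV §4.3] -/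
theorem setLIntegral_ideleUnitBox_compl_union_eq_tsum
    (hϖ : ∀ v, Valued.v ((ϖ v : (v.adicCompletion K)ˣ) : v.adicCompletion K) = exp (-1 : ℤ))
    {S T : Finset (HeightOneSpectrum (𝓞 K))} (hTS : ∀ v ∈ T, v ∉ S) (h : ideleGroup K → ℝ≥0∞) :
    ∫⁻ y in ideleUnitBox (K := K) {w | w ∉ S ∪ T}, h y ∂ν =
      ∑' m : ↥T → ℤ, ∫⁻ b in ideleUnitBox (K := K) {w | w ∉ S}, h (shellIdele ϖ T m * b) ∂ν := by
  haveI : SecondCountableTopology (ideleGroup K) := secondCountableTopology_ideleGroup K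
  haveI : MeasurableMul (ideleGroup K) := ContinuousMul.measurableMul
  rw [ideleUnitBox_compl_union_eq_iUnion ϖ hϖ S T,
    lintegral_iUnion (measurableSet_shellIdele_smul_ideleUnitBox_compl ϖ hϖ S T)
      (pairwise_disjoint_shellIdele_smul_ideleUnitBox_compl ϖ hϖ hTS)]
  exact tsum_congr fun m => setLIntegral_smul_left_eq ν _ _ h

variable {E : Type*} [NormedAddCommGroup E] [NormedSpace ℝ E]

omit [BorelSpace (ideleGroup K)] in
/-- `∫_{t B} f dν = ∫_B f(t b) dν(b)` (Bochner) for a left-invariant `ν`. [folklore] -/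
theorem setIntegral_smul_left_eq [MeasurableMul (ideleGroup K)] (t : ideleGroup K) (B : Set (ideleGroup K))
    (f : ideleGroup K → E) :
    ∫ y in t • B, f y ∂ν = ∫ b in B, f (t * b) ∂ν := by
  have hmp : MeasurePreserving (MeasurableEquiv.mulLeft t) ν ν := measurePreserving_mul_left ν t
  have hpre : (MeasurableEquiv.mulLeft t) ⁻¹' (t • B) = B := by
    ext a
    simp only [MeasurableEquiv.coe_mulLeft, Set.mem_preimage]
    exact Set.smul_mem_smul_set_iff
  calc ∫ y in t • B, f y ∂ν
      = ∫ a in (MeasurableEquiv.mulLeft t) ⁻¹' (t • B), f (MeasurableEquiv.mulLeft t a) ∂ν :=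
        (hmp.setIntegral_preimage_emb (MeasurableEquiv.mulLeft t).measurableEmbedding _ _).symm
    _ = ∫ b in B, f (t * b) ∂ν := by rw [hpre]; rfl

omit [BorelSpace (ideleGroup K)] [NormedSpace ℝ E] in
/-- `f` is integrable on `t B` iff `b ↦ f(t b)` is integrable on `B`, for a left-invariant `ν`. [folklore] -/
theorem integrableOn_smul_left_iff [MeasurableMul (ideleGroup K)] (t : ideleGroup K) (B : Set (ideleGroup K))
    (f : ideleGroup K → E) :
    IntegrableOn f (t • B) ν ↔ IntegrableOn (fun b => f (t * b)) B ν := by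
  have hmp : MeasurePreserving (MeasurableEquiv.mulLeft t) ν ν := measurePreserving_mul_left ν t
  have hpre : (MeasurableEquiv.mulLeft t) ⁻¹' (t • B) = B := by
    ext a
    simp only [MeasurableEquiv.coe_mulLeft, Set.mem_preimage]
    exact Set.smul_mem_smul_set_iff
  have h := hmp.integrableOn_comp_preimage (MeasurableEquiv.mulLeft t).measurableEmbedding (f := f) (s := t • B)
  rw [hpre] at h
  exact h.symm

/-- **`∫_{B((S ∪ T)ᶜ)} f dν = Σ_{m ∈ ℤ^T} ∫_{B(Sᶜ)} f(ϖ^m b) dν(b)`** (Bochner, as a `HasSum`) for `f`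
integrable on `B((S ∪ T)ᶜ)` and `ν` left-invariant (`T ∩ S = ∅`). [cite: CasselsFrohlichANT1967, Ch. XV §4.3] -/
theorem hasSum_setIntegral_ideleUnitBox_compl_union
    (hϖ : ∀ v, Valued.v ((ϖ v : (v.adicCompletion K)ˣ) : v.adicCompletion K) = exp (-1 : ℤ))
    {S T : Finset (HeightOneSpectrum (𝓞 K))} (hTS : ∀ v ∈ T, v ∉ S) {f : ideleGroup K → E}
    (hf : IntegrableOn f (ideleUnitBox (K := K) {w | w ∉ S ∪ T}) ν) :
    HasSum (fun m : ↥T → ℤ => ∫ b in ideleUnitBox (K := K) {w | w ∉ S}, f (shellIdele ϖ T m * b) ∂ν)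
      (∫ y in ideleUnitBox (K := K) {w | w ∉ S ∪ T}, f y ∂ν) := by
  haveI : SecondCountableTopology (ideleGroup K) := secondCountableTopology_ideleGroup K
  haveI : MeasurableMul (ideleGroup K) := ContinuousMul.measurableMul
  rw [ideleUnitBox_compl_union_eq_iUnion ϖ hϖ S T] at hf ⊢
  have h := hasSum_integral_iUnion (measurableSet_shellIdele_smul_ideleUnitBox_compl ϖ hϖ S T)
    (pairwise_disjoint_shellIdele_smul_ideleUnitBox_compl ϖ hϖ hTS) hf
  have heq : (fun m : ↥T → ℤ => ∫ b in ideleUnitBox (K := K) {w | w ∉ S}, f (shellIdele ϖ T m * b) ∂ν) =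
      fun m => ∫ x in shellIdele ϖ T m • ideleUnitBox (K := K) {w | w ∉ S}, f x ∂ν :=
    funext fun m => (setIntegral_smul_left_eq ν _ _ f).symm
  rw [heq]
  exact h

omit [NormedSpace ℝ E] in
/-- The shells of an integrable `f` are integrable: `b ↦ f(ϖ^m b)` is integrable on `B(Sᶜ)` for every
`m ∈ ℤ^T` when `f` is integrable on `B((S ∪ T)ᶜ)`. [folklore] -/
theorem integrableOn_shell_of_integrableOn_ideleUnitBox_compl_union
    (hϖ : ∀ v, Valued.v ((ϖ v : (v.adicCompletion K)ˣ) : v.adicCompletion K) = exp (-1 : ℤ))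
    {S T : Finset (HeightOneSpectrum (𝓞 K))} {f : ideleGroup K → E}
    (hf : IntegrableOn f (ideleUnitBox (K := K) {w | w ∉ S ∪ T}) ν) (m : ↥T → ℤ) :
    IntegrableOn (fun b => f (shellIdele ϖ T m * b)) (ideleUnitBox (K := K) {w | w ∉ S}) ν := by
  haveI : SecondCountableTopology (ideleGroup K) := secondCountableTopology_ideleGroup K
  haveI : MeasurableMul (ideleGroup K) := ContinuousMul.measurableMul
  rw [← integrableOn_smul_left_iff ν]
  refine hf.mono_set ?_
  rw [ideleUnitBox_compl_union_eq_iUnion ϖ hϖ S T]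
  exact Set.subset_iUnion (fun m : ↥T → ℤ => shellIdele ϖ T m • ideleUnitBox (K := K) {w | w ∉ S}) m

end RelativeShells

/-! ### 3. Integrals over `𝕀_K` as limits over the boxes -/

section Exhaustion

variable [MeasurableSpace (ideleGroup K)] [BorelSpace (ideleGroup K)] (ν : Measure (ideleGroup K))

/-- `B(Sᶜ)` is measurable (uniformizers chosen inside). [folklore] -/
theorem measurableSet_ideleUnitBox_compl' (S : Finset (HeightOneSpectrum (𝓞 K))) :
    MeasurableSet (ideleUnitBox (K := K) {w | w ∉ S}) :=
  measurableSet_ideleUnitBox_compl (fun v => GaloisRepresentations.HeckeCharacter.uniformizer K v)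
    (fun v => GaloisRepresentations.HeckeCharacter.valued_uniformizer v) S

/-- **`∫_{B(Sᶜ)} f dν → ∫_{𝕀_K} f dν` along the finite sets `S ↑`** for `f` integrable on `𝕀_K` (continuity
of the Bochner integral along the increasing exhaustion by the boxes; the finite places are countable).
[cite: CasselsFrohlichANT1967, Ch. XV §4.3] -/
theorem tendsto_setIntegral_ideleUnitBox_compl {E : Type*} [NormedAddCommGroup E] [NormedSpace ℝ E]
    {f : ideleGroup K → E} (hf : Integrable f ν) :
    Tendsto (fun S : Finset (HeightOneSpectrum (𝓞 K)) => ∫ a in ideleUnitBox (K := K) {w | w ∉ S}, f a ∂ν)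
      atTop (𝓝 (∫ a, f a ∂ν)) := by
  haveI : Countable (HeightOneSpectrum (𝓞 K)) := countable_heightOneSpectrum K
  have h := tendsto_setIntegral_of_monotone (μ := ν) (f := f)
    (s := fun S : Finset (HeightOneSpectrum (𝓞 K)) => ideleUnitBox (K := K) {w | w ∉ S})
    (fun S => measurableSet_ideleUnitBox_compl' S) monotone_ideleUnitBox_compl
    (by rw [iUnion_ideleUnitBox_compl]; exact hf.integrableOn)
  rwa [iUnion_ideleUnitBox_compl, Measure.restrict_univ] at h

omit [BorelSpace (ideleGroup K)] in
/-- **`∫⁻_{𝕀_K} h dν = ⨆_S ∫⁻_{B(Sᶜ)} h dν`** for `h ≥ 0`. [cite: CasselsFrohlichANT1967, Ch. XV §4.3] -/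
theorem lintegral_eq_iSup_setLIntegral_ideleUnitBox_compl (h : ideleGroup K → ℝ≥0∞) :
    ∫⁻ a, h a ∂ν = ⨆ S : Finset (HeightOneSpectrum (𝓞 K)), ∫⁻ a in ideleUnitBox (K := K) {w | w ∉ S}, h a ∂ν := by
  haveI : Countable (HeightOneSpectrum (𝓞 K)) := countable_heightOneSpectrum K
  have hd : Directed (· ⊆ ·) fun S : Finset (HeightOneSpectrum (𝓞 K)) => ideleUnitBox (K := K) {w | w ∉ S} :=
    fun S S' => ⟨S ∪ S', monotone_ideleUnitBox_compl Finset.subset_union_left,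
      monotone_ideleUnitBox_compl Finset.subset_union_right⟩
  rw [← setLIntegral_iUnion_of_directed h hd, iUnion_ideleUnitBox_compl, Measure.restrict_univ]

omit [BorelSpace (ideleGroup K)] in
/-- **Integrability on `𝕀_K` from a uniform bound over the boxes**: if `f` is a.e. strongly measurable and
`∫⁻_{B(Sᶜ)} ‖f‖ dν ≤ C < ∞` for every finite `S`, then `f` is integrable on `𝕀_K` (the absolute convergence
of an unfolded adelic integral from a uniform bound on its Euler products over finite sets of places).
[cite: CogdellAnalyticTheory2004, §2.3] -/
theorem integrable_of_setLIntegral_ideleUnitBox_compl_le {E : Type*} [NormedAddCommGroup E]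
    {f : ideleGroup K → E} (hfm : AEStronglyMeasurable f ν) {C : ℝ≥0∞} (hC : C ≠ ∞)
    (hle : ∀ S : Finset (HeightOneSpectrum (𝓞 K)), ∫⁻ a in ideleUnitBox (K := K) {w | w ∉ S}, ‖f a‖ₑ ∂ν ≤ C) :
    Integrable f ν := by
  refine ⟨hfm, ?_⟩
  show ∫⁻ a, ‖f a‖ₑ ∂ν < ∞
  rw [lintegral_eq_iSup_setLIntegral_ideleUnitBox_compl ν]
  exact lt_of_le_of_lt (iSup_le hle) hC.lt_top

end Exhaustion

end Literature.NumberTheory.Automorphic
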